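import Literature.ModelTheory.ExponentialFields.SemialgebraicPanelBeating
import Mathlib.Analysis.SpecialFunctions.Sqrt
import HarnessLib

/-!
# Panel beating, III-a: the derivative of the squeeze and its limit at the simplex

Topic `Literature/ModelTheory/ExponentialFields` — the calculus behind (2.8) of
[CzaplaPawlucki2018, §2 Part II] for the squeeze `g = proj + φ(s) • perp` of a squeeze frame
(`SemialgebraicPanelBeating.lean`): on `{ω > 0, r > 0}` the squeeze is differentiable with
`Dg(x) = P + φ'(s) (Ds ·) perp x + φ(s) (I - P)`, `P` the linear projection onto the direction
space of the simplex along the transversal complement `W`, and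
`‖Dg(x) - P‖ ≤ 6 s (n ‖I - P‖ s + ε ‖Dω(x)‖ s²) + 3 s² ‖I - P‖` for `s = s(x) ≤ 1` — so
`Dg → P` when approaching interior points of the simplex (`s → 0` with `Dω` bounded), which is
the source of (2.9)–(2.11) of loc. cit.

* `projLin`, `proj_add`, `hasFDerivAt_proj`, `hasFDerivAt_perp`, `projLin_of_mem_W`,
  `projLin_of_mem_dirSpan`;
* `radDeriv`, `hasFDerivAt_rad`, `norm_radDeriv_le`;
* `sDeriv`, `hasFDerivAt_sparam`, `hasFDerivAt_sqz`, `norm_fderiv_sqz_sub_projLin_le`.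

No named facts are introduced.

## References

* [CzaplaPawlucki2018] M. Czapla, W. Pawłucki, *Strict `C¹`-triangulations in o-minimal
  structures*, TMNA 52 (2018), §2 Part II, (2.8)–(2.11).
-/

open Set Filter
open _root_.Topology

namespace Literature.ModelTheory.ExponentialFields

namespace SqueezeFrame

variable {n : ℕ} (F : SqueezeFrame n)

/-! ## The linear part of the projection -/

/-- The linear part `P` of the affine projection `proj`: `P y = Σ_v λ_v(y, 0) v`.
[cite: CzaplaPawlucki2018, §2 Part II] -/
noncomputable def projLin : (Fin n → ℝ) →L[ℝ] (Fin n → ℝ) :=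
  LinearMap.toContinuousLinearMap
    { toFun := fun y => ∑ v, F.lam (y, 0) v • (v : Fin n → ℝ)
      map_add' := fun y z => by
        have : ((y + z, (0 : ℝ)) : (Fin n → ℝ) × ℝ) = (y, 0) + (z, 0) := by simp
        rw [this, map_add]
        simp [add_smul, Finset.sum_add_distrib]
      map_smul' := fun c y => by
        have : ((c • y, (0 : ℝ)) : (Fin n → ℝ) × ℝ) = c • (y, 0) := by simp
        rw [this, map_smul]
        simp [Finset.smul_sum, smul_smul] }

/-- `projLin` unfolded. [cite: CzaplaPawlucki2018, §2 Part II] -/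
theorem projLin_apply (y : Fin n → ℝ) : F.projLin y = ∑ v, F.lam (y, 0) v • (v : Fin n → ℝ) := rfl

/-- **`proj` is affine with linear part `P`.** [cite: CzaplaPawlucki2018, §2 Part II] -/
theorem proj_add (x y : Fin n → ℝ) : F.proj (x + y) = F.proj x + F.projLin y := by
  have h : F.bary (x + y) = F.bary x + F.lam (y, 0) := by
    have : ((x + y, (1 : ℝ)) : (Fin n → ℝ) × ℝ) = (x, 1) + (y, 0) := by simp
    rw [bary, this, map_add, bary]
  simp only [proj, h, Pi.add_apply, add_smul, Finset.sum_add_distrib, projLin_apply]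

/-- The derivative of `proj` is `P`. [cite: CzaplaPawlucki2018, §2 Part II] -/
theorem hasFDerivAt_proj (x : Fin n → ℝ) : HasFDerivAt F.proj F.projLin x := by
  have h : F.proj = fun y => F.proj 0 + F.projLin y := by
    funext y; rw [← F.proj_add 0 y, zero_add]
  rw [h]
  exact (F.projLin.hasFDerivAt).const_add _

/-- The derivative of `perp` is `I - P`. [cite: CzaplaPawlucki2018, §2 Part II] -/
theorem hasFDerivAt_perp (x : Fin n → ℝ) :
    HasFDerivAt F.perp (ContinuousLinearMap.id ℝ (Fin n → ℝ) - F.projLin) x :=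
  (hasFDerivAt_id x).sub (F.hasFDerivAt_proj x)

/-- `P` kills the transversal complement. [cite: CzaplaPawlucki2018, §2 Part II] -/
theorem projLin_of_mem_W {w : Fin n → ℝ} (hw : w ∈ F.W) : F.projLin w = 0 := by
  have h := F.proj_add 0 w
  rw [F.proj_add_of_mem_W 0 hw] at h
  exact add_eq_left.mp h.symm

/-- `P` is the identity on the direction space. [cite: CzaplaPawlucki2018, §2 Part II] -/
theorem projLin_of_mem_dirSpan {t : Fin n → ℝ} (ht : t ∈ dirSpan F.τ F.v₀) : F.projLin t = t := by
  classical
  obtain ⟨c, rfl⟩ := LinearMap.mem_range.mp ht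
  -- `t = Σ c_v (v - v₀) = Σ w_v v` with `Σ w_v = 0`
  set w : F.τ → ℝ := c - (∑ v, c v) • F.delta₀ with hw
  have hsum : ∑ v, w v = 0 := by
    simp only [hw, Pi.sub_apply, Pi.smul_apply, smul_eq_mul, Finset.sum_sub_distrib, ← Finset.mul_sum,
      F.sum_delta₀, mul_one, sub_self]
  have ht' : Fintype.linearCombination ℝ (fun v : F.τ => (v : Fin n → ℝ) - F.v₀) c = ∑ v, w v • (v : Fin n → ℝ) := by
    rw [Fintype.linearCombination_apply]
    simp only [hw, Pi.sub_apply, Pi.smul_apply, smul_eq_mul, sub_smul, Finset.sum_sub_distrib, smul_sub]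
    congr 1
    have h1 : ∑ v : F.τ, ((∑ u, c u) * F.delta₀ v) • (v : Fin n → ℝ) = (∑ u, c u) • F.v₀ := by
      simp only [delta₀, Pi.single_apply]
      rw [Finset.sum_eq_single (⟨F.v₀, F.hv₀⟩ : F.τ)]
      · simp
      · intro v _ hv; simp [hv]
      · simp
    rw [h1, ← Finset.sum_smul]
  have hwm : weightMap F.τ w = (∑ v, w v • (v : Fin n → ℝ), 0) := by rw [weightMap_apply, hsum]
  have hlam : F.lam (∑ v, w v • (v : Fin n → ℝ), 0) = w := by
    rw [← hwm]
    exact LinearMap.linearProjOfIsCompl_apply_left _ _ _ _ w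
  rw [ht', projLin_apply, hlam]

/-! ## The derivative of the radius -/

/-- The derivative of `r` at a point with `r > 0`:
`Dr(x) h = (1/r) Σ_i perp_i(x) ((I - P) h)_i`. [cite: CzaplaPawlucki2018, §2 Part II] -/
noncomputable def radDeriv (x : Fin n → ℝ) : (Fin n → ℝ) →L[ℝ] ℝ :=
  (F.rad x)⁻¹ • ∑ i, F.perp x i • ((ContinuousLinearMap.proj i).comp
    (ContinuousLinearMap.id ℝ (Fin n → ℝ) - F.projLin))

/-- **`r` is differentiable where positive**, with derivative `radDeriv`.
[cite: CzaplaPawlucki2018, §2 Part II] -/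
theorem hasFDerivAt_rad {x : Fin n → ℝ} (hr : 0 < F.rad x) : HasFDerivAt F.rad (F.radDeriv x) x := by
  -- `q = Σ perp_i²`
  have hq : HasFDerivAt (fun y => ∑ i, F.perp y i ^ 2)
      (∑ i, (2 * F.perp x i) • ((ContinuousLinearMap.proj i).comp
        (ContinuousLinearMap.id ℝ (Fin n → ℝ) - F.projLin))) x := by
    refine HasFDerivAt.fun_sum fun i _ => ?_
    have hpi : HasFDerivAt (fun y => F.perp y i) ((ContinuousLinearMap.proj i).comp
        (ContinuousLinearMap.id ℝ (Fin n → ℝ) - F.projLin)) x :=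
      ((ContinuousLinearMap.proj (R := ℝ) (ι := Fin n) (φ := fun _ => ℝ) i).hasFDerivAt).comp x
        (F.hasFDerivAt_perp x)
    have := hpi.pow 2
    simpa [pow_one] using this
  have hqpos : 0 < ∑ i, F.perp x i ^ 2 := by
    have := F.rad_sq x; rw [← this]; positivity
  have hsqrt : HasDerivAt Real.sqrt (1 / (2 * Real.sqrt (∑ i, F.perp x i ^ 2))) (∑ i, F.perp x i ^ 2) :=
    Real.hasDerivAt_sqrt hqpos.ne'
  have h := hsqrt.comp_hasFDerivAt x hq
  have hrad : Real.sqrt (∑ i, F.perp x i ^ 2) = F.rad x := rfl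
  rw [hrad] at h
  refine h.congr_fderiv ?_
  rw [radDeriv, Finset.smul_sum, Finset.smul_sum]
  refine Finset.sum_congr rfl fun i _ => ?_
  rw [smul_smul, smul_smul]
  congr 1
  field_simp

/-- **The derivative of `r` is bounded** independently of the point: `‖Dr(x)‖ ≤ n ‖I - P‖`.
[cite: CzaplaPawlucki2018, §2 Part II] -/
theorem norm_radDeriv_le {x : Fin n → ℝ} (hr : 0 < F.rad x) :
    ‖F.radDeriv x‖ ≤ n * ‖ContinuousLinearMap.id ℝ (Fin n → ℝ) - F.projLin‖ := by
  refine ContinuousLinearMap.opNorm_le_bound _ (by positivity) fun h => ?_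
  simp only [radDeriv, FunLike.coe_smul, FunLike.coe_sum, Pi.smul_apply,
    Finset.sum_apply]
  rw [norm_smul, norm_inv, Real.norm_of_nonneg (F.rad_nonneg x)]
  have hterm : ∀ i, ‖(F.perp x i • ((ContinuousLinearMap.proj i).comp
      (ContinuousLinearMap.id ℝ (Fin n → ℝ) - F.projLin))) h‖ ≤
      F.rad x * (‖ContinuousLinearMap.id ℝ (Fin n → ℝ) - F.projLin‖ * ‖h‖) := by
    intro i
    rw [FunLike.coe_smul, Pi.smul_apply, norm_smul]
    refine mul_le_mul ((Real.norm_eq_abs _).le.trans (F.abs_perp_le_rad x i)) ?_ (norm_nonneg _) (F.rad_nonneg x)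
    calc ‖((ContinuousLinearMap.proj i).comp (ContinuousLinearMap.id ℝ (Fin n → ℝ) - F.projLin)) h‖
        = ‖((ContinuousLinearMap.id ℝ (Fin n → ℝ) - F.projLin) h) i‖ := rfl
      _ ≤ ‖(ContinuousLinearMap.id ℝ (Fin n → ℝ) - F.projLin) h‖ := norm_le_pi_norm _ i
      _ ≤ ‖ContinuousLinearMap.id ℝ (Fin n → ℝ) - F.projLin‖ * ‖h‖ := ContinuousLinearMap.le_opNorm _ _
  calc (F.rad x)⁻¹ * ‖∑ i, (F.perp x i • ((ContinuousLinearMap.proj i).comp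
        (ContinuousLinearMap.id ℝ (Fin n → ℝ) - F.projLin))) h‖
      ≤ (F.rad x)⁻¹ * ∑ i, ‖(F.perp x i • ((ContinuousLinearMap.proj i).comp
        (ContinuousLinearMap.id ℝ (Fin n → ℝ) - F.projLin))) h‖ := by
        gcongr; exact norm_sum_le _ _
    _ ≤ (F.rad x)⁻¹ * ∑ _i : Fin n, F.rad x * (‖ContinuousLinearMap.id ℝ (Fin n → ℝ) - F.projLin‖ * ‖h‖) := by
        gcongr with i; exact hterm i
    _ = n * ‖ContinuousLinearMap.id ℝ (Fin n → ℝ) - F.projLin‖ * ‖h‖ := by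
        rw [Finset.sum_const, Finset.card_univ, Fintype.card_fin, nsmul_eq_mul]
        field_simp

/-! ## The derivative of the squeeze -/

/-- The derivative of the parameter `s = r / (ε ω)` (a name for the formula).
[cite: CzaplaPawlucki2018, §2 Part II] -/
noncomputable def sDeriv (ε : ℝ) (x : Fin n → ℝ) : (Fin n → ℝ) →L[ℝ] ℝ :=
  (ε * F.omega x)⁻¹ • F.radDeriv x + (-(F.rad x * ε / (ε * F.omega x) ^ 2)) • fderiv ℝ F.omega x

/-- **`s` is differentiable on `{ω > 0, r > 0}`.** [cite: CzaplaPawlucki2018, §2 Part II] -/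
theorem hasFDerivAt_sparam {ε : ℝ} (hε : ε ≠ 0) {x : Fin n → ℝ} (hω : 0 < F.omega x) (hr : 0 < F.rad x) :
    HasFDerivAt (F.sparam ε) (F.sDeriv ε x) x := by
  have hω' : HasFDerivAt (fun y => ε * F.omega y) (ε • fderiv ℝ F.omega x) x :=
    ((F.contDiff_omega.differentiable (by simp)).differentiableAt.hasFDerivAt).const_mul ε
  have hne : ε * F.omega x ≠ 0 := mul_ne_zero hε hω.ne'
  have hinv : HasFDerivAt (fun y => (ε * F.omega y)⁻¹) (-((ε * F.omega x) ^ 2)⁻¹ • (ε • fderiv ℝ F.omega x)) x :=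
    (hasDerivAt_inv hne).comp_hasFDerivAt x hω'
  have h := (F.hasFDerivAt_rad hr).mul hinv
  have hfun : F.sparam ε = fun y => F.rad y * (ε * F.omega y)⁻¹ := by
    funext y; rw [sparam, div_eq_mul_inv]
  rw [hfun]
  refine h.congr_fderiv ?_
  rw [sDeriv, add_comm, smul_smul, smul_smul]
  congr 2
  field_simp

/-- **The squeeze is differentiable on `{ω > 0, r > 0}`**, with
`Dg = P + φ(s) (I - P) + φ'(s) (Ds ·) perp`. [cite: CzaplaPawlucki2018, §2 Part II, (2.8)] -/
theorem hasFDerivAt_sqz {ε : ℝ} (hε : ε ≠ 0) {x : Fin n → ℝ} (hω : 0 < F.omega x) (hr : 0 < F.rad x) :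
    HasFDerivAt (F.sqz ε)
      (F.projLin + (smoothstep (F.sparam ε x) • (ContinuousLinearMap.id ℝ (Fin n → ℝ) - F.projLin) +
        (deriv smoothstep (F.sparam ε x) • F.sDeriv ε x).smulRight (F.perp x))) x := by
  have hφ : HasFDerivAt (fun y => smoothstep (F.sparam ε y)) (deriv smoothstep (F.sparam ε x) • F.sDeriv ε x) x := by
    have h1 : HasDerivAt smoothstep (deriv smoothstep (F.sparam ε x)) (F.sparam ε x) := by
      rw [deriv_smoothstep]; exact hasDerivAt_smoothstep _
    exact h1.comp_hasFDerivAt x (F.hasFDerivAt_sparam hε hω hr)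
  have h := (F.hasFDerivAt_proj x).add (hφ.smul (F.hasFDerivAt_perp x))
  exact h

/-- **The limit estimate `Dg → P`**: for `s = s(x) ∈ (0, 1]`,
`‖Dg(x) - P‖ ≤ 3 s² ‖I - P‖ + 6 s (n ‖I - P‖ s + ε ‖Dω(x)‖ s²)`.
[cite: CzaplaPawlucki2018, §2 Part II, (2.8)–(2.9)] -/
theorem norm_fderiv_sqz_sub_projLin_le {ε : ℝ} (hε : 0 < ε) {x : Fin n → ℝ} (hω : 0 < F.omega x)
    (hr : 0 < F.rad x) (hs1 : F.sparam ε x ≤ 1) :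
    ‖fderiv ℝ (F.sqz ε) x - F.projLin‖ ≤
      3 * F.sparam ε x ^ 2 * ‖ContinuousLinearMap.id ℝ (Fin n → ℝ) - F.projLin‖ +
        6 * F.sparam ε x * (n * ‖ContinuousLinearMap.id ℝ (Fin n → ℝ) - F.projLin‖ * F.sparam ε x +
          ε * ‖fderiv ℝ F.omega x‖ * F.sparam ε x ^ 2) := by
  set s := F.sparam ε x with hs
  set Q := ContinuousLinearMap.id ℝ (Fin n → ℝ) - F.projLin with hQ
  have hs0 : 0 < s := div_pos hr (mul_pos hε hω)
  have hsI : s ∈ Icc (0 : ℝ) 1 := ⟨hs0.le, hs1⟩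
  have hεω : 0 < ε * F.omega x := mul_pos hε hω
  have hrad : F.rad x = s * (ε * F.omega x) := by rw [hs, sparam]; field_simp
  rw [(F.hasFDerivAt_sqz hε.ne' hω hr).fderiv]
  have hrew : F.projLin + (smoothstep s • Q + (deriv smoothstep s • F.sDeriv ε x).smulRight (F.perp x)) - F.projLin =
      smoothstep s • Q + (deriv smoothstep s • F.sDeriv ε x).smulRight (F.perp x) := by abel
  rw [hrew]
  -- the two terms
  have hφ : smoothstep s = 3 * s ^ 2 - 2 * s ^ 3 := smoothstep_of_mem hsI
  have hφ' : deriv smoothstep s = 6 * s * (1 - s) := by rw [deriv_smoothstep, stepClamp_of_mem hsI]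
  have h1 : ‖smoothstep s • Q‖ ≤ 3 * s ^ 2 * ‖Q‖ := by
    rw [norm_smul, Real.norm_of_nonneg (smoothstep_mem_Icc s).1, hφ]
    refine mul_le_mul_of_nonneg_right ?_ (norm_nonneg _)
    nlinarith [pow_pos hs0 3]
  have hS : ‖F.sDeriv ε x‖ * F.rad x ≤ n * ‖Q‖ * s + ε * ‖fderiv ℝ F.omega x‖ * s ^ 2 := by
    have hRD := F.norm_radDeriv_le hr
    calc ‖F.sDeriv ε x‖ * F.rad x
        ≤ (‖(ε * F.omega x)⁻¹ • F.radDeriv x‖ + ‖(-(F.rad x * ε / (ε * F.omega x) ^ 2)) • fderiv ℝ F.omega x‖) * F.rad x := by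
          refine mul_le_mul_of_nonneg_right (norm_add_le _ _) (F.rad_nonneg x)
      _ = ((ε * F.omega x)⁻¹ * ‖F.radDeriv x‖ + F.rad x * ε / (ε * F.omega x) ^ 2 * ‖fderiv ℝ F.omega x‖) * F.rad x := by
          rw [norm_smul, norm_smul, norm_inv, Real.norm_of_nonneg hεω.le, norm_neg,
            Real.norm_of_nonneg (by positivity)]
      _ ≤ ((ε * F.omega x)⁻¹ * (n * ‖Q‖) + F.rad x * ε / (ε * F.omega x) ^ 2 * ‖fderiv ℝ F.omega x‖) * F.rad x := by
          gcongr
      _ = n * ‖Q‖ * s + ε * ‖fderiv ℝ F.omega x‖ * s ^ 2 := by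
          rw [hrad]; field_simp
  have h2 : ‖(deriv smoothstep s • F.sDeriv ε x).smulRight (F.perp x)‖ ≤
      6 * s * (n * ‖Q‖ * s + ε * ‖fderiv ℝ F.omega x‖ * s ^ 2) := by
    rw [ContinuousLinearMap.norm_smulRight_apply, norm_smul, hφ', Real.norm_of_nonneg (by nlinarith)]
    calc 6 * s * (1 - s) * ‖F.sDeriv ε x‖ * ‖F.perp x‖
        ≤ 6 * s * 1 * ‖F.sDeriv ε x‖ * F.rad x := by
          gcongr
          · linarith
          · exact F.norm_perp_le_rad x
      _ = 6 * s * (‖F.sDeriv ε x‖ * F.rad x) := by ring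
      _ ≤ 6 * s * (n * ‖Q‖ * s + ε * ‖fderiv ℝ F.omega x‖ * s ^ 2) := by gcongr
  calc ‖smoothstep s • Q + (deriv smoothstep s • F.sDeriv ε x).smulRight (F.perp x)‖
      ≤ ‖smoothstep s • Q‖ + ‖(deriv smoothstep s • F.sDeriv ε x).smulRight (F.perp x)‖ := norm_add_le _ _
    _ ≤ _ := add_le_add h1 h2

end SqueezeFrame

end Literature.ModelTheory.ExponentialFields
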